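import Summits.ValiantsHypothesis.ValiantsHypothesis.Theorems.KPlusLogSqLawTropicalOrbitDominance
import Summits.ValiantsHypothesis.ValiantsHypothesis.Theorems.LacunarySymmetroidMatrixDescartesCensusTropicalKLawStatic

/-!
# Tropical census — the CROSSING two-column exchange rule for uniquely dominant terms, and the letter / sign dictionary of
# symmetric `3 × 3` single-term chains

HONEST FRAMING.  Helper file (seat val-sym-lift-p2 (g5), cell `pub-symmetroid`, 2026-08-27; `--supports` the `WeakLifting` item
stmt-ValiantsHypothesis-19561 as a helper, no closure claim; desk GO R1601 (i), «the two-point lemma layer (L)+(C)+(G)»).  General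
statements about the tree's single-term dominance model (`MatrixDescartes.Negative.IsDominant`), valid for every format `(m, K)` and
integer slopes, with no sweep object, no strictness and no adjacency; plus the `m = 3` symmetric dictionary.  They are the rule lemmas
of the pairwise relaxation that bounds the symmetric single-term `(3,4)` row by `15` at cell level (HOME/val-sym-lift-p2/g5/
PAIRWISE-CEILING-liftp2g5.md; two codes with theory-2 g19); the finite per-face part of that bound is NOT in this file and NOT claimed
(kernel window of record for the symmetric single-term `(3,4)` row: `[15, 18]`, p469079 / p459728).  Nothing here bears on `TropicalB` /
`WeakLifting` in their windows, the real census (DoorA34 = `PosRootLawAt 3 4 18`, OPEN, never asserted), `MatrixDescartes`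
(stmt-ValiantsHypothesis-18050) or VP ≠ VNP.

CONTENT.
* §1 `sum_d_lt_of_dominant_cross` / `d_add_d_lt_of_dominant_cross` — **crossing exchange** (rule (C) of the memo, general form): if
  `(σ, μ)` is the unique optimum at `θa` and `(τ, ν)` at `θb > θa`, and on two columns `i ≠ j` the permutations CROSS (`τ i = σ j`,
  `τ j = σ i`), then `d (μ i) + d (μ j) < d (ν i) + d (ν j)`.  Proof: the two HYBRID terms (`σ ∘ swap i j` with `ν` on `{i,j}` and `μ`
  elsewhere; `τ ∘ swap i j` with `μ` on `{i,j}` and `ν` elsewhere) are present and differ from the optima; the weight differences are one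
  affine function of `θ` and its negative, positive at `θa` resp. `θb` (`Orbit.affine_cross`).  The single-column companion (rule (L),
  same row at column `i`) is the tree's `TropicalCensus.d_lt_of_dominant_entry`; the all-columns companion (rule (S)) is
  `slope_lt_of_dominant`.  The orbit-model version with identity/transposition carriers and ASSUMED hybrid presence is `Orbit.rule_R1w`
  (theory g23 / typer g11); here presence is derived and the carriers are arbitrary.
* §2 the symmetric `3 × 3` dictionary: an involution of `Fin 3` is `1` or a transposition (`perm_three_of_involutive`), so a uniquely
  dominant term of a symmetric `3 × 3` design is an identity term `D(a)` or a transposition term `T = (swap i j, c)` with `c i = c j`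
  (`dominant_symm_three_cases`, from `isDominant_symm_involutive`); the two CANCELLATION inequalities between a `D`-term and a `T`-term of
  a chain in either order (`d_add_d_lt_two_mul_of_dominant`, `two_mul_lt_d_add_d_of_dominant`: the shared diagonal letter cancels);
  the term signs `termSign ε (1, a) = ∏ ε_ll(a_l)` and, for symmetric `ε`, `termSign ε (swap i j, c) = −ε_ij(c_i)² · ε_kk(c_k)`
  (`termSign_one_eq`, `termSign_swap_symm_three`).
[folklore two-point exchange arguments; cell memos HOME/theory/g23/method/TSYM34-METHOD-g23.md §3 and PAIRWISE-CEILING-liftp2g5.md §1]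
-/

-- `Summit.ValiantsHypothesis.ValiantsHypothesis.…` repeats a component by the D-0017 layout
-- (single-conjunct summit), which the `dupNamespace` linter flags; the name is mandated.
set_option linter.dupNamespace false
set_option autoImplicit false

namespace Summit.ValiantsHypothesis.ValiantsHypothesis.Theorems.LacunarySymmetroidMatrixDescartes.TropicalCensus

open Summit.ValiantsHypothesis.ValiantsHypothesis.Theorems.MatrixDescartes.Negative
open Summit.ValiantsHypothesis.ValiantsHypothesis.Theorems.LacunarySymmetroidMatrixDescartes
open Finset

variable {m K : ℕ}

/-! ## §1 The crossing two-column exchange rule (any format, any carriers) -/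

/-- the hybrid carrier `σ ∘ swap i j` uses `τ`'s rows on the crossing columns and `σ`'s rows elsewhere. [folklore] -/
theorem mul_swap_apply_eq (σ τ : Equiv.Perm (Fin m)) {i j : Fin m} (hij : i ≠ j) (hτi : τ i = σ j) (hτj : τ j = σ i)
    (l : Fin m) : (σ * Equiv.swap i j) l = if l = i ∨ l = j then τ l else σ l := by
  rw [Equiv.Perm.mul_apply]
  by_cases hi : l = i
  · subst hi
    rw [Equiv.swap_apply_left, if_pos (Or.inl rfl), hτi]
  · by_cases hj : l = j
    · subst hj
      rw [Equiv.swap_apply_right, if_pos (Or.inr rfl), hτj]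
    · rw [Equiv.swap_apply_of_ne_of_ne hi hj, if_neg (not_or.mpr ⟨hi, hj⟩)]

/-- a hybrid of two present terms is present. [folklore] -/
theorem termSign_hybrid_ne_zero (ε : Fin m → Fin m → Fin K → ℤ) (σ τ π : Equiv.Perm (Fin m)) (μ ν : Fin m → Fin K)
    {i j : Fin m} (hπ : ∀ l, π l = if l = i ∨ l = j then τ l else σ l)
    (hσ : termSign ε (σ, μ) ≠ 0) (hτ : termSign ε (τ, ν) ≠ 0) :
    termSign ε (π, fun l => if l = i ∨ l = j then ν l else μ l) ≠ 0 := by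
  unfold termSign
  refine mul_ne_zero (Units.ne_zero _) (prod_ne_zero_iff.mpr fun l _ => ?_)
  dsimp only
  rw [hπ l]
  by_cases h : l = i ∨ l = j
  · rw [if_pos h, if_pos h]; exact present_of_termSign_ne_zero ε (τ, ν) hτ l
  · rw [if_neg h, if_neg h]; exact present_of_termSign_ne_zero ε (σ, μ) hσ l

/-- **Crossing exchange rule, sum form.**  `(σ, μ)` uniquely dominant at `θa`, `(τ, ν)` at `θb > θa`, the carriers crossing on
the columns `i ≠ j` (`τ i = σ j`, `τ j = σ i`): the exponent sum of `μ` is below that of the hybrid `ν` on `{i,j}` / `μ` elsewhere.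
[folklore two-point exchange; cf. `Orbit.rule_R1w`] -/
theorem sum_d_lt_of_dominant_cross (d : Fin K → ℕ) (v ε : Fin m → Fin m → Fin K → ℤ) {θa θb : ℤ} (hab : θa < θb)
    (σ τ : Equiv.Perm (Fin m)) (μ ν : Fin m → Fin K)
    (ha : IsDominant d v ε θa (σ, μ)) (hb : IsDominant d v ε θb (τ, ν))
    {i j : Fin m} (hij : i ≠ j) (hτi : τ i = σ j) (hτj : τ j = σ i) :
    ∑ l, (d (μ l) : ℤ) < ∑ l, (d (if l = i ∨ l = j then ν l else μ l) : ℤ) := by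
  have hσi : σ i = τ j := hτj.symm
  have hσj : σ j = τ i := hτi.symm
  have rX := mul_swap_apply_eq σ τ hij hτi hτj
  have rY := mul_swap_apply_eq τ σ hij hσi hσj
  have hsw : Equiv.swap i j ≠ (1 : Equiv.Perm (Fin m)) := fun h => hij (Equiv.swap_eq_refl_iff.mp h)
  -- the hybrids are present and differ from the optima (their carriers differ)
  have hX := termSign_hybrid_ne_zero ε σ τ (σ * Equiv.swap i j) μ ν rX ha.1 hb.1
  have hY := termSign_hybrid_ne_zero ε τ σ (τ * Equiv.swap i j) ν μ rY hb.1 ha.1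
  have hXne : ((σ * Equiv.swap i j, fun l => if l = i ∨ l = j then ν l else μ l) :
      Equiv.Perm (Fin m) × (Fin m → Fin K)) ≠ (σ, μ) := fun h =>
    hsw (mul_left_cancel (a := σ) (by rw [mul_one]; exact congrArg Prod.fst h))
  have hYne : ((τ * Equiv.swap i j, fun l => if l = i ∨ l = j then μ l else ν l) :
      Equiv.Perm (Fin m) × (Fin m → Fin K)) ≠ (τ, ν) := fun h =>
    hsw (mul_left_cancel (a := τ) (by rw [mul_one]; exact congrArg Prod.fst h))
  have c1 := ha.2 _ hXne hX
  have c2 := hb.2 _ hYne hY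
  simp only [tropWeight] at c1 c2
  -- termwise bookkeeping: exponent sums and height sums of {optima} and {hybrids} agree
  have hd : ∑ l, (d (μ l) : ℤ) + ∑ l, (d (ν l) : ℤ) =
      ∑ l, (d (if l = i ∨ l = j then ν l else μ l) : ℤ) + ∑ l, (d (if l = i ∨ l = j then μ l else ν l) : ℤ) := by
    rw [← sum_add_distrib, ← sum_add_distrib]
    refine sum_congr rfl fun l _ => ?_
    by_cases h : l = i ∨ l = j <;> simp [h, add_comm]
  have hc : ∑ l, v (σ l) l (μ l) + ∑ l, v (τ l) l (ν l) =
      ∑ l, v ((σ * Equiv.swap i j) l) l (if l = i ∨ l = j then ν l else μ l) +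
        ∑ l, v ((τ * Equiv.swap i j) l) l (if l = i ∨ l = j then μ l else ν l) := by
    rw [← sum_add_distrib, ← sum_add_distrib]
    refine sum_congr rfl fun l _ => ?_
    rw [rX l, rY l]
    by_cases h : l = i ∨ l = j
    · simp [h, add_comm]
    · simp [h]
  exact Orbit.affine_cross hab hd hc c1 c2

/-- **Crossing exchange rule (rule (C), general carriers).**  `(σ, μ)` uniquely dominant at `θa`, `(τ, ν)` at `θb > θa`, carriers
crossing on the columns `i ≠ j` ⇒ `d (μ i) + d (μ j) < d (ν i) + d (ν j)`. [folklore two-point exchange] -/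
theorem d_add_d_lt_of_dominant_cross (d : Fin K → ℕ) (v ε : Fin m → Fin m → Fin K → ℤ) {θa θb : ℤ} (hab : θa < θb)
    (σ τ : Equiv.Perm (Fin m)) (μ ν : Fin m → Fin K)
    (ha : IsDominant d v ε θa (σ, μ)) (hb : IsDominant d v ε θb (τ, ν))
    {i j : Fin m} (hij : i ≠ j) (hτi : τ i = σ j) (hτj : τ j = σ i) :
    d (μ i) + d (μ j) < d (ν i) + d (ν j) := by
  have h := sum_d_lt_of_dominant_cross d v ε hab σ τ μ ν ha hb hij hτi hτj
  rw [← sub_pos, ← sum_sub_distrib] at h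
  -- the difference vanishes off `{i, j}`
  have hvan : ∀ l ∈ (univ : Finset (Fin m)), l ∉ ({i, j} : Finset (Fin m)) →
      ((d (if l = i ∨ l = j then ν l else μ l) : ℤ) - d (μ l)) = 0 := by
    intro l _ hl
    rw [mem_insert, mem_singleton] at hl
    rw [if_neg hl, sub_self]
  rw [← sum_subset (subset_univ _) hvan, sum_pair hij, if_pos (Or.inl rfl), if_pos (Or.inr rfl)] at h
  have : (d (μ i) : ℤ) + d (μ j) < d (ν i) + d (ν j) := by linarith
  exact_mod_cast this

/-! ## §2 The symmetric `3 × 3` dictionary: carriers, cancellation, signs -/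

/-- the involutions of `Fin 3` are the identity and the three transpositions. [folklore] -/
theorem perm_three_of_involutive : ∀ σ : Equiv.Perm (Fin 3), (∀ i, σ (σ i) = i) →
    σ = 1 ∨ σ = Equiv.swap 0 1 ∨ σ = Equiv.swap 0 2 ∨ σ = Equiv.swap 1 2 := by decide

/-- **Carriers of a symmetric `3 × 3` single-term chain.**  A uniquely dominant term of a symmetric `3 × 3` design (any `K`) is an
identity term `(1, c)` or a transposition term `(swap i j, c)`, `i < j`, with equal classes on the 2-cycle (`c i = c j`).
[from `isDominant_symm_involutive`] -/
theorem dominant_symm_three_cases (d : Fin K → ℕ) (v ε : Fin 3 → Fin 3 → Fin K → ℤ)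
    (hv : ∀ i j l, v i j l = v j i l) (hε : ∀ i j l, ε i j l = ε j i l) (θ : ℤ)
    (σ : Equiv.Perm (Fin 3)) (c : Fin 3 → Fin K) (h : IsDominant d v ε θ (σ, c)) :
    σ = 1 ∨ ∃ i j : Fin 3, i < j ∧ σ = Equiv.swap i j ∧ c i = c j := by
  obtain ⟨hinv, hcc⟩ := isDominant_symm_involutive d v ε hv hε θ σ c h
  rcases perm_three_of_involutive σ hinv with h1 | h1 | h1 | h1
  · exact Or.inl h1
  · refine Or.inr ⟨0, 1, by decide, h1, ?_⟩
    have := hcc 0; rw [h1, Equiv.swap_apply_left] at this; exact this.symm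
  · refine Or.inr ⟨0, 2, by decide, h1, ?_⟩
    have := hcc 0; rw [h1, Equiv.swap_apply_left] at this; exact this.symm
  · refine Or.inr ⟨1, 2, by decide, h1, ?_⟩
    have := hcc 1; rw [h1, Equiv.swap_apply_left] at this; exact this.symm

/-- **Cancellation, `D` before `T`** (any `m`, `K`; no symmetry needed): if the identity term `(1, a)` is uniquely dominant at `θa`
and a transposition term `(swap i j, c)` with `c i = c j` at `θb > θa`, then `d (a i) + d (a j) < 2 · d (c i)` — the shared
diagonal letters cancel, which slope increase alone does not give. [rule (C) of PAIRWISE-CEILING-liftp2g5 §1] -/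
theorem d_add_d_lt_two_mul_of_dominant (d : Fin K → ℕ) (v ε : Fin m → Fin m → Fin K → ℤ) {θa θb : ℤ} (hab : θa < θb)
    (a c : Fin m → Fin K) {i j : Fin m} (hij : i ≠ j) (hc : c i = c j)
    (ha : IsDominant d v ε θa (1, a)) (hb : IsDominant d v ε θb (Equiv.swap i j, c)) :
    d (a i) + d (a j) < 2 * d (c i) := by
  have h := d_add_d_lt_of_dominant_cross d v ε hab 1 (Equiv.swap i j) a c ha hb hij
    (by rw [Equiv.swap_apply_left, Equiv.Perm.one_apply]) (by rw [Equiv.swap_apply_right, Equiv.Perm.one_apply])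
  rw [← hc] at h
  omega

/-- **Cancellation, `T` before `D`**: if `(swap i j, c)` with `c i = c j` is uniquely dominant at `θa` and the identity term `(1, a)` at
`θb > θa`, then `2 · d (c i) < d (a i) + d (a j)`. [rule (C), second half] -/
theorem two_mul_lt_d_add_d_of_dominant (d : Fin K → ℕ) (v ε : Fin m → Fin m → Fin K → ℤ) {θa θb : ℤ} (hab : θa < θb)
    (c a : Fin m → Fin K) {i j : Fin m} (hij : i ≠ j) (hc : c i = c j)
    (ha : IsDominant d v ε θa (Equiv.swap i j, c)) (hb : IsDominant d v ε θb (1, a)) :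
    2 * d (c i) < d (a i) + d (a j) := by
  have h := d_add_d_lt_of_dominant_cross d v ε hab (Equiv.swap i j) 1 c a ha hb hij
    (by rw [Equiv.swap_apply_right, Equiv.Perm.one_apply]) (by rw [Equiv.swap_apply_left, Equiv.Perm.one_apply])
  rw [← hc] at h
  omega

/-- sign of an identity term: the product of its diagonal letter signs. [folklore] -/
theorem termSign_one_eq (ε : Fin m → Fin m → Fin K → ℤ) (a : Fin m → Fin K) :
    termSign ε (1, a) = ∏ l, ε l l (a l) := by
  unfold termSign
  simp

/-- in `Fin 3`, the complement of a pair is the third index. [folklore] -/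
theorem univ_erase_erase_three : ∀ i j k : Fin 3, i ≠ j → k ≠ i → k ≠ j →
    ((univ.erase i).erase j : Finset (Fin 3)) = {k} := by decide

/-- **Sign of a transposition term of a symmetric `3 × 3` design**: for `{i, j, k} = Fin 3` and `c i = c j`,
`termSign ε (swap i j, c) = −ε_ij(c_i)² · ε_kk(c_k)`; so along a chain its sign is the OPPOSITE of the fixed diagonal letter's sign
(the off-diagonal letter enters squared). [rule (G); folklore] -/
theorem termSign_swap_symm_three (ε : Fin 3 → Fin 3 → Fin K → ℤ) (hε : ∀ i j l, ε i j l = ε j i l)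
    {i j k : Fin 3} (hij : i ≠ j) (hki : k ≠ i) (hkj : k ≠ j) (c : Fin 3 → Fin K) (hc : c i = c j) :
    termSign ε (Equiv.swap i j, c) = -(ε i j (c i) ^ 2 * ε k k (c k)) := by
  unfold termSign
  dsimp only
  rw [Equiv.Perm.sign_swap hij]
  have hk : k ∈ (univ.erase i).erase j := by simp [hki, hkj]
  rw [← mul_prod_erase _ _ (mem_univ i), ← mul_prod_erase _ _ (mem_erase.mpr ⟨hij.symm, mem_univ j⟩),
    univ_erase_erase_three i j k hij hki hkj, prod_singleton, Equiv.swap_apply_left, Equiv.swap_apply_right,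
    Equiv.swap_apply_of_ne_of_ne hki hkj, ← hc, hε j i]
  simp only [Units.val_neg, Units.val_one]
  ring

/-- **Sign comparison along a chain** (corollary): with `ε i j (c i) ≠ 0`, the product of the transposition term's sign with any
integer `r` is negative iff `−ε_kk(c_k) · r` is. [rule (G)] -/
theorem termSign_swap_mul_neg_iff (ε : Fin 3 → Fin 3 → Fin K → ℤ) (hε : ∀ i j l, ε i j l = ε j i l)
    {i j k : Fin 3} (hij : i ≠ j) (hki : k ≠ i) (hkj : k ≠ j) (c : Fin 3 → Fin K) (hc : c i = c j)
    (hpres : ε i j (c i) ≠ 0) (r : ℤ) :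
    termSign ε (Equiv.swap i j, c) * r < 0 ↔ -(ε k k (c k)) * r < 0 := by
  rw [termSign_swap_symm_three ε hε hij hki hkj c hc]
  have hsq : 0 < ε i j (c i) ^ 2 := by positivity
  constructor
  · intro h
    by_contra hcon
    push Not at hcon
    have : 0 ≤ ε i j (c i) ^ 2 * (-(ε k k (c k)) * r) := mul_nonneg hsq.le hcon
    nlinarith
  · intro h
    nlinarith [mul_neg_of_pos_of_neg hsq h]

end Summit.ValiantsHypothesis.ValiantsHypothesis.Theorems.LacunarySymmetroidMatrixDescartes.TropicalCensus
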